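import Mathlib
import Literature.Analysis.FluidPDE.SpaceTimeRescaling
import Literature.Analysis.FluidPDE.SelfSimilarCollapseAnsatz
import Summits.NavierStokesRegularity.NavierStokesRegularity.Theorems.EulerZoomLiouvillePowerGaugeEulerLiouvilleGalileanFictitiousForceTools
import HarnessLib

/-!
# The `D`-gauge of a PAST-EXACT member in profile variables: dyadic `L^{3/2}` growth of the pressure profile (T2 lane tool for the past twin)
# (crux `EulerZoomLiouville.PowerGaugeEulerLiouville` = stmt-NavierStokesRegularity-19832; LEAD ns-typeII-p2 g12 v75 «past twin please»; width seat ns-ezl-w1 g4)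

Route №10 `EulerZoomLiouville` (NavierStokesRegularity).  Past twin of the pressure half of `profile_pressure_weight_of_gaugeD` (`…SelfSimilarPressure`)
in the form a PAST member can supply: if `p(τ, x) = (T−τ)^{2γ−2} P((T−τ)^{−γ}(x − x₀))` for `τ < T₁` (`T₁ ≤ 0`, `T₁ ≤ T`, `γ = 1/(2+ρ)`,
`0 < ρ < 1`) and `a^{2ρ} D(a; 0, 0) ≤ c` for all `a > 0`, then `∫_{B_L} |P|^{3/2} ≤ C_D L^{2−2ρ}` for all `L ≥ 1`.  Proof: the FIXED far-past window
`τ ∈ (T₁−2, T₁−1)` (length one, where `s = T − τ ∈ (s₁, s₁+1)`, `s₁ = T − T₁ + 1 ≥ 1`) inside the cylinder `Q_a(0,0)`,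
`a = L(s₁+1)^γ + ‖x₀‖ + 2 − T₁`: on each slice the change of variables `x = x₀ + s^γ y` gives
`∫_{B_a}|p(τ)|^{3/2} ≥ s^{6γ−3} ∫_{B_L}|P|^{3/2} ≥ (s₁+1)^{6γ−3} ∫_{B_L}|P|^{3/2}`, and Tonelli over the window against
`∫∫_{Q_a}|p|^{3/2} ≤ c a^{2−2ρ} ≲ L^{2−2ρ}` (`GalileanFrames.setLIntegral_cylinder_enorm_rpow_le_of_gaugeD`).
(The WEIGHTED datum `∫|P|^{3/2}‖y‖^{2ρ−2} < ∞` of the origin-anchored case is NOT available for `T₁ < T`: the window never reaches the collapse.)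

* `profile_pressure_growth_of_gaugeD_past`.

HONEST LABEL: tool.  WHAT THIS IS NOT: not NS, not E — `--supports` stmt-19832; 19832 OPEN. [folklore; CaffarelliKohnNirenberg1982 §2]
-/

noncomputable section

-- flat `Theorems/<Route><Decl>…` files of one crux share the namespace of the crux (tree convention)
set_option linter.dupNamespace false

open MeasureTheory Set Filter Topology Metric Function InnerProductSpace TopologicalSpace
open scoped RealInnerProductSpace NNReal ENNReal

namespace Summit.NavierStokesRegularity.NavierStokesRegularity.Theorems.PowerGaugeEulerLiouville.PressureParking

open Literature.Analysis Literature.Analysis.FluidPDE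

/-- **THE `D`-GAUGE OF A PAST-EXACT MEMBER IN PROFILE VARIABLES (dyadic growth).**  `p(τ,·) = (T−τ)^{2γ−2}P((T−τ)^{−γ}(· − x₀))` for `τ < T₁`
(`T₁ ≤ 0`, `T₁ ≤ T`, `γ = 1/(2+ρ)`, `0 < ρ < 1`), `uncurry p` a.e.-strongly measurable on the slab, `a^{2ρ} D(a; 0,0) ≤ c` for all `a > 0`
⇒ `∫_{B_L}|P|^{3/2} ≤ C_D L^{2−2ρ}` for `L ≥ 1`. [folklore; CaffarelliKohnNirenberg1982 §2] -/
theorem profile_pressure_growth_of_gaugeD_past {ρ : ℝ} (hρ : 0 < ρ) (hρ1 : ρ < 1) {T T₁ : ℝ} (hT₁ : T₁ ≤ 0) (hTT₁ : T₁ ≤ T)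
    (x₀ : EuclideanSpace ℝ (Fin 3)) {p : ℝ → EuclideanSpace ℝ (Fin 3) → ℝ} {P : EuclideanSpace ℝ (Fin 3) → ℝ} {c : ℝ≥0}
    (hpm : AEStronglyMeasurable (uncurry p)
      (volume.restrict (Iio (0 : ℝ) ×ˢ (univ : Set (EuclideanSpace ℝ (Fin 3))))))
    (hp : ∀ τ : ℝ, τ < T₁ → p τ = fun x => selfSimilarCollapsePressure (1 / (2 + ρ)) T P τ (x - x₀))
    (hD : ∀ a : ℝ, 0 < a → ENNReal.ofReal (a ^ (2 * ρ)) * cknD a (0 : ℝ × EuclideanSpace ℝ (Fin 3)) p ≤ (c : ℝ≥0∞)) :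
    ∃ CD : ℝ, 0 ≤ CD ∧ ∀ L : ℝ, 1 ≤ L →
      ∫⁻ y in ball (0 : EuclideanSpace ℝ (Fin 3)) L, ‖P y‖ₑ ^ (3 / 2 : ℝ) ≤ ENNReal.ofReal (CD * L ^ (2 - 2 * ρ)) := by
  set γ : ℝ := 1 / (2 + ρ) with hγ
  have h2ρ : (0 : ℝ) < 2 + ρ := by linarith
  have hγ0 : 0 < γ := by rw [hγ]; positivity
  -- the far-past window `W = (T₁ − 2, T₁ − 1)` and the range of `s = T − τ`
  set s₁ : ℝ := T - T₁ + 1 with hs₁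
  have hs₁1 : 1 ≤ s₁ := by rw [hs₁]; linarith
  set W : Set ℝ := Ioo (T₁ - 2) (T₁ - 1) with hWdef
  have hsW : ∀ τ ∈ W, s₁ ≤ T - τ ∧ T - τ ≤ s₁ + 1 := fun τ hτ => by
    rw [hWdef, mem_Ioo] at hτ; rw [hs₁]; constructor <;> linarith
  -- constants
  set σ₁ : ℝ := (s₁ + 1) ^ γ with hσ₁
  have hσ₁0 : 0 < σ₁ := Real.rpow_pos_of_pos (by linarith) _
  set m₀ : ℝ := (s₁ + 1) ^ (6 * γ - 3) with hm₀
  have hm₀0 : 0 < m₀ := Real.rpow_pos_of_pos (by linarith) _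
  set K : ℝ := σ₁ + ‖x₀‖ + (2 - T₁) with hK
  have hK0 : 0 < K := by rw [hK]; linarith [norm_nonneg x₀]
  refine ⟨(c : ℝ) * K ^ (2 - 2 * ρ) / m₀, by positivity, fun L hL => ?_⟩
  have hL0 : 0 < L := by linarith
  -- the radius
  set a : ℝ := K * L with ha
  have ha0 : 0 < a := by positivity
  have haK : K ≤ a := by rw [ha]; exact le_mul_of_one_le_right hK0.le hL
  have ha2 : 2 - T₁ ≤ a := by
    have : 2 - T₁ ≤ K := by rw [hK]; linarith [norm_nonneg x₀, hσ₁0.le]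
    exact this.trans haK
  have haa : a ≤ a ^ 2 := by nlinarith
  have hWsub : W ⊆ Ioo (-(a ^ 2)) 0 := fun τ hτ => by
    rw [hWdef, mem_Ioo] at hτ
    exact ⟨by linarith, by linarith⟩
  -- ## the cylinder bound from the `D`-gauge
  have htot := GalileanFrames.setLIntegral_cylinder_enorm_rpow_le_of_gaugeD hD ha0
  -- ## Tonelli over the window
  set g : ℝ × EuclideanSpace ℝ (Fin 3) → ℝ≥0∞ := fun z => ‖p z.1 z.2‖ₑ ^ (3 / 2 : ℝ) with hg
  have hμ : (volume : Measure (ℝ × EuclideanSpace ℝ (Fin 3))).restrict (W ×ˢ ball (0 : EuclideanSpace ℝ (Fin 3)) a) =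
      ((volume : Measure ℝ).restrict W).prod
        ((volume : Measure (EuclideanSpace ℝ (Fin 3))).restrict (ball (0 : EuclideanSpace ℝ (Fin 3)) a)) := by
    rw [Measure.prod_restrict, ← Measure.volume_eq_prod]
  have hgm : AEMeasurable g (((volume : Measure ℝ).restrict W).prod
      ((volume : Measure (EuclideanSpace ℝ (Fin 3))).restrict (ball (0 : EuclideanSpace ℝ (Fin 3)) a))) := by
    rw [← hμ]
    exact (hpm.mono_measure (Measure.restrict_mono (prod_mono (fun t ht => (hWsub ht).2) (subset_univ _))
      le_rfl)).enorm.pow_const _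
  have hTon : ∫⁻ τ in W, ∫⁻ x in ball (0 : EuclideanSpace ℝ (Fin 3)) a, ‖p τ x‖ₑ ^ (3 / 2 : ℝ) ≤
      ENNReal.ofReal ((c : ℝ) * a ^ (2 - 2 * ρ)) := by
    calc ∫⁻ τ in W, ∫⁻ x in ball (0 : EuclideanSpace ℝ (Fin 3)) a, ‖p τ x‖ₑ ^ (3 / 2 : ℝ)
        = ∫⁻ z in W ×ˢ ball (0 : EuclideanSpace ℝ (Fin 3)) a, g z := by rw [hμ, lintegral_prod _ hgm]
      _ ≤ ∫⁻ z in Ioo (-(a ^ 2)) 0 ×ˢ ball (0 : EuclideanSpace ℝ (Fin 3)) a, g z :=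
          lintegral_mono_set (prod_mono hWsub subset_rfl)
      _ ≤ ENNReal.ofReal ((c : ℝ) * a ^ (2 - 2 * ρ)) := htot
  -- ## each slice of the window dominates `m₀ ∫_{B_L} |P|^{3/2}`
  set J : ℝ≥0∞ := ∫⁻ y in ball (0 : EuclideanSpace ℝ (Fin 3)) L, ‖P y‖ₑ ^ (3 / 2 : ℝ) with hJ
  have hslice : ∀ τ ∈ W, ENNReal.ofReal m₀ * J ≤ ∫⁻ x in ball (0 : EuclideanSpace ℝ (Fin 3)) a, ‖p τ x‖ₑ ^ (3 / 2 : ℝ) := by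
    intro τ hτ
    obtain ⟨hs1, hs2⟩ := hsW τ hτ
    set s : ℝ := T - τ with hsdef
    have hs0 : 0 < s := by linarith
    have hτT₁ : τ < T₁ := by rw [hWdef, mem_Ioo] at hτ; linarith
    set σ : ℝ := s ^ γ with hσdef
    have hσ0 : 0 < σ := Real.rpow_pos_of_pos hs0 _
    have hσle : σ ≤ σ₁ := by rw [hσdef, hσ₁]; exact Real.rpow_le_rpow hs0.le hs2 hγ0.le
    -- values on the slice
    have hval : ∀ y : EuclideanSpace ℝ (Fin 3),
        ‖p τ (x₀ + σ • y)‖ₑ ^ (3 / 2 : ℝ) = ENNReal.ofReal ((s ^ (2 * (γ - 1))) ^ (3 / 2 : ℝ)) * ‖P y‖ₑ ^ (3 / 2 : ℝ) := by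
      intro y
      rw [hp τ hτT₁]
      simp only [selfSimilarCollapsePressure_apply, add_sub_cancel_left, smul_smul]
      rw [hσdef, ← Real.rpow_add hs0, show -γ + γ = 0 by ring, Real.rpow_zero, one_smul,
        enorm_mul, ENNReal.mul_rpow_of_nonneg _ _ (by norm_num : (0 : ℝ) ≤ 3 / 2),
        Real.enorm_eq_ofReal (Real.rpow_nonneg hs0.le _), ENNReal.ofReal_rpow_of_nonneg (Real.rpow_nonneg hs0.le _)
          (by norm_num : (0 : ℝ) ≤ 3 / 2)]
    have hpre : ball (0 : EuclideanSpace ℝ (Fin 3)) L ⊆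
        (fun y : EuclideanSpace ℝ (Fin 3) => x₀ + σ • y) ⁻¹' ball (0 : EuclideanSpace ℝ (Fin 3)) a := by
      intro y hy
      rw [mem_ball_zero_iff] at hy
      rw [mem_preimage, mem_ball_zero_iff]
      calc ‖x₀ + σ • y‖ ≤ ‖x₀‖ + ‖σ • y‖ := norm_add_le _ _
        _ = ‖x₀‖ + σ * ‖y‖ := by rw [norm_smul, Real.norm_of_nonneg hσ0.le]
        _ < ‖x₀‖ + σ₁ * L := by
            have : σ * ‖y‖ < σ * L := mul_lt_mul_of_pos_left hy hσ0
            have : σ * L ≤ σ₁ * L := mul_le_mul_of_nonneg_right hσle hL0.le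
            linarith
        _ ≤ a := by
            rw [ha, hK]
            have : ‖x₀‖ ≤ ‖x₀‖ * L := le_mul_of_one_le_right (norm_nonneg _) hL
            nlinarith [norm_nonneg x₀]
    have hcov := setLIntegral_preimage_comp_space_affine hσ0 x₀
      (fun x : EuclideanSpace ℝ (Fin 3) => ‖p τ x‖ₑ ^ (3 / 2 : ℝ)) (ball (0 : EuclideanSpace ℝ (Fin 3)) a)
    rw [finrank_euclideanSpace_fin] at hcov
    -- `σ³ (s^{2γ−2})^{3/2} = s^{6γ−3} ≥ m₀`
    have hpow : σ ^ 3 * (s ^ (2 * (γ - 1))) ^ (3 / 2 : ℝ) = s ^ (6 * γ - 3) := by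
      rw [hσdef, ← Real.rpow_natCast, ← Real.rpow_mul hs0.le, ← Real.rpow_mul hs0.le, ← Real.rpow_add hs0]
      congr 1
      push_cast
      ring
    have hm₀le : m₀ ≤ s ^ (6 * γ - 3) := by
      rw [hm₀]
      refine Real.rpow_le_rpow_of_nonpos hs0 hs2 ?_
      have : γ < 1 / 2 := by rw [hγ]; exact one_div_lt_one_div_of_lt two_pos (by linarith)
      linarith
    -- assemble the slice bound
    have h1 : ENNReal.ofReal ((s ^ (2 * (γ - 1))) ^ (3 / 2 : ℝ)) * J ≤
        ENNReal.ofReal (σ ^ 3)⁻¹ * ∫⁻ x in ball (0 : EuclideanSpace ℝ (Fin 3)) a, ‖p τ x‖ₑ ^ (3 / 2 : ℝ) := by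
      rw [← hcov, hJ, ← lintegral_const_mul' _ _ ENNReal.ofReal_ne_top]
      calc ∫⁻ y in ball (0 : EuclideanSpace ℝ (Fin 3)) L, ENNReal.ofReal ((s ^ (2 * (γ - 1))) ^ (3 / 2 : ℝ)) * ‖P y‖ₑ ^ (3 / 2 : ℝ)
          = ∫⁻ y in ball (0 : EuclideanSpace ℝ (Fin 3)) L, ‖p τ (x₀ + σ • y)‖ₑ ^ (3 / 2 : ℝ) :=
            lintegral_congr fun y => (hval y).symm
        _ ≤ _ := lintegral_mono_set hpre
    have hσ3 : 0 < σ ^ 3 := pow_pos hσ0 3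
    calc ENNReal.ofReal m₀ * J ≤ ENNReal.ofReal (s ^ (6 * γ - 3)) * J :=
          mul_le_mul' (ENNReal.ofReal_le_ofReal hm₀le) le_rfl
      _ = ENNReal.ofReal (σ ^ 3) * (ENNReal.ofReal ((s ^ (2 * (γ - 1))) ^ (3 / 2 : ℝ)) * J) := by
          rw [← mul_assoc, ← ENNReal.ofReal_mul hσ3.le, hpow]
      _ ≤ ENNReal.ofReal (σ ^ 3) * (ENNReal.ofReal (σ ^ 3)⁻¹ *
            ∫⁻ x in ball (0 : EuclideanSpace ℝ (Fin 3)) a, ‖p τ x‖ₑ ^ (3 / 2 : ℝ)) := mul_le_mul' le_rfl h1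
      _ = ∫⁻ x in ball (0 : EuclideanSpace ℝ (Fin 3)) a, ‖p τ x‖ₑ ^ (3 / 2 : ℝ) := by
          rw [← mul_assoc, ENNReal.ofReal_inv_of_pos hσ3, ENNReal.mul_inv_cancel
            ((ENNReal.ofReal_pos.2 hσ3).ne') ENNReal.ofReal_ne_top, one_mul]
  -- ## integrate the slice bound over the window (length one)
  have hWvol : volume W = 1 := by rw [hWdef, Real.volume_Ioo]; norm_num
  have hlow : ENNReal.ofReal m₀ * J ≤ ∫⁻ τ in W, ∫⁻ x in ball (0 : EuclideanSpace ℝ (Fin 3)) a, ‖p τ x‖ₑ ^ (3 / 2 : ℝ) := by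
    calc ENNReal.ofReal m₀ * J = ∫⁻ τ in W, ENNReal.ofReal m₀ * J := by
          rw [setLIntegral_const, hWvol, mul_comm _ (1 : ℝ≥0∞), one_mul]
      _ ≤ _ := setLIntegral_mono' measurableSet_Ioo fun τ hτ => hslice τ hτ
  -- ## conclude
  have hfin : ENNReal.ofReal m₀ * J ≤ ENNReal.ofReal ((c : ℝ) * a ^ (2 - 2 * ρ)) := hlow.trans hTon
  have hJle : J ≤ ENNReal.ofReal m₀⁻¹ * ENNReal.ofReal ((c : ℝ) * a ^ (2 - 2 * ρ)) := by
    calc J = ENNReal.ofReal m₀⁻¹ * (ENNReal.ofReal m₀ * J) := by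
          rw [← mul_assoc, ENNReal.ofReal_inv_of_pos hm₀0, ENNReal.inv_mul_cancel
            ((ENNReal.ofReal_pos.2 hm₀0).ne') ENNReal.ofReal_ne_top, one_mul]
      _ ≤ _ := mul_le_mul' le_rfl hfin
  refine hJle.trans (le_of_eq ?_)
  rw [← ENNReal.ofReal_mul (inv_nonneg.2 hm₀0.le), ha, Real.mul_rpow hK0.le hL0.le]
  congr 1
  field_simp

end Summit.NavierStokesRegularity.NavierStokesRegularity.Theorems.PowerGaugeEulerLiouville.PressureParking

end
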